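import Summits.Ventures.DiscreteObjects.PP12.OrbitCountOrderThree

/-!
# Orbit-matrix identities at plane level for a collineation of PRIME order `p` (kernel; any finite projective plane)
Framing: lottery ticket; floor = certified bounds/negative ranges.

Cell pub-namedobj (venture DiscreteObjects), target (M), designs gen 15. `OrbitCountOrderThree` (designs g13) proves the `λ = 1` double-counting identity
behind every orbit-matrix ('tactical decomposition') computation for `σ³ = 1`, with the orbit written as the literal finset `{x, σx, σ²x}`. The remaining cells
of the PP(12) collineation census that are settled only in print or only outside the kernel are of prime order `p = 5` (a fixed Fano subplane; Janko–van Trung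
1982, designs g10's replication), `p = 11`, `p = 13` (Janko–van Trung); their kernel reductions need the same identity for a general prime. This file provides it:
* `orbP τ p x = {τ^k x : k < p}`; for `τ^p = 1`, `p` prime: `σ`-stable, transitive, `= {x}` for a fixed point and of size `p` otherwise (`card_orbP_of_ne` — the
  only place primality enters: a proper period `d` would be coprime to `p`), and two orbits are equal or disjoint (`orbP_eq_of_mem`);
* `orbP_incidence_symm` — `#{b' ∈ B : q ∈ b'}·|Q| = |Q ∩ b|·|B|` for a point orbit `Q` and a line orbit `B`;
* **`orbit_row_identity_prime`** — for a non-fixed line `b` (orbit `B`, `|B| = p`) and any line `a`: `Σ_{q ∈ a} w_b(q) = p + n·[a ∈ B]` with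
  `w_b(q) = p·[q ∈ b]` (`q` fixed) resp. `|orbP q ∩ b|`; **`orbit_column_identity_prime`** dually.
For `p = 3` these are `OrbitCountOrderThree.orbit_row_identity` / `orbit_column_identity` (up to the name of the orbit finset). Classical (Dembowski §4.1,
Hughes 1957); nothing is specific to order 12. No `sorry`, no new axioms.
-/

namespace Summit.Ventures.DiscreteObjects.PP12

open Configuration Finset
open scoped Classical

section Perm

variable {α : Type*}

/-- The orbit `{x, τ x, …, τ^{p-1} x}` of `x` under a permutation with `τ ^ p = 1`, as a finset. -/
noncomputable def orbP (τ : Equiv.Perm α) (p : ℕ) (x : α) : Finset α := (Finset.range p).image fun k => (τ ^ k) x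

/-- membership in `orbP` -/
theorem mem_orbP (τ : Equiv.Perm α) (p : ℕ) (x y : α) : y ∈ orbP τ p x ↔ ∃ k, k < p ∧ (τ ^ k) x = y := by
  unfold orbP; rw [mem_image]
  exact ⟨fun ⟨k, hk, e⟩ => ⟨k, mem_range.1 hk, e⟩, fun ⟨k, hk, e⟩ => ⟨k, mem_range.2 hk, e⟩⟩

/-- `x ∈ orbP x` (`p > 0`). -/
theorem self_mem_orbP (τ : Equiv.Perm α) {p : ℕ} (hp : 0 < p) (x : α) : x ∈ orbP τ p x :=
  (mem_orbP τ p x x).2 ⟨0, hp, by simp⟩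

/-- Powers reduce mod `p` when `τ ^ p = 1`. -/
theorem pow_apply_eq_pow_mod (τ : Equiv.Perm α) {p : ℕ} (h : τ ^ p = 1) (n : ℕ) (x : α) : (τ ^ n) x = (τ ^ (n % p)) x := by
  conv_lhs => rw [← Nat.mod_add_div n p, pow_add, pow_mul, h, one_pow, mul_one]

/-- Every power of `τ` maps `x` into `orbP x` (`τ ^ p = 1`, `p > 0`). -/
theorem pow_apply_mem_orbP (τ : Equiv.Perm α) {p : ℕ} (h : τ ^ p = 1) (hp : 0 < p) (n : ℕ) (x : α) : (τ ^ n) x ∈ orbP τ p x :=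
  (mem_orbP τ p x _).2 ⟨n % p, Nat.mod_lt n hp, (pow_apply_eq_pow_mod τ h n x).symm⟩

/-- `orbP x` is `τ`-stable. -/
theorem apply_mem_orbP (τ : Equiv.Perm α) {p : ℕ} (h : τ ^ p = 1) (hp : 0 < p) {x y : α} (hy : y ∈ orbP τ p x) : τ y ∈ orbP τ p x := by
  obtain ⟨k, -, rfl⟩ := (mem_orbP τ p x y).1 hy
  have : τ ((τ ^ k) x) = (τ ^ (k + 1)) x := by rw [pow_succ']; rfl
  rw [this]; exact pow_apply_mem_orbP τ h hp (k + 1) x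

/-- `τ` is onto on `orbP x`. -/
theorem exists_apply_eq_of_mem_orbP (τ : Equiv.Perm α) {p : ℕ} (h : τ ^ p = 1) (hp : 0 < p) {x y : α} (hy : y ∈ orbP τ p x) :
    ∃ z ∈ orbP τ p x, τ z = y := by
  obtain ⟨k, -, rfl⟩ := (mem_orbP τ p x y).1 hy
  refine ⟨(τ ^ (k + (p - 1))) x, pow_apply_mem_orbP τ h hp _ x, ?_⟩
  have e : τ ((τ ^ (k + (p - 1))) x) = (τ ^ (k + (p - 1) + 1)) x := by rw [pow_succ']; rfl
  rw [e, show k + (p - 1) + 1 = k + p by omega, pow_add, h, mul_one]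

/-- the orbit of a fixed point is a singleton (`p > 0`) -/
theorem orbP_of_fixed (τ : Equiv.Perm α) {p : ℕ} (hp : 0 < p) {x : α} (hx : τ x = x) : orbP τ p x = {x} := by
  ext y
  rw [mem_orbP, mem_singleton]
  constructor
  · rintro ⟨k, -, rfl⟩
    exact Equiv.Perm.pow_apply_eq_self_of_apply_eq_self hx k
  · rintro rfl; exact ⟨0, hp, by simp⟩

/-- Orbits are equal as soon as they meet: `y ∈ orbP x → orbP y = orbP x` (`τ ^ p = 1`, `p > 0`). -/
theorem orbP_eq_of_mem (τ : Equiv.Perm α) {p : ℕ} (h : τ ^ p = 1) (hp : 0 < p) {x y : α} (hy : y ∈ orbP τ p x) : orbP τ p y = orbP τ p x := by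
  obtain ⟨k, hk, rfl⟩ := (mem_orbP τ p x y).1 hy
  apply Finset.Subset.antisymm
  · intro z hz
    obtain ⟨j, -, rfl⟩ := (mem_orbP τ p _ z).1 hz
    rw [← Equiv.Perm.mul_apply, ← pow_add]
    exact pow_apply_mem_orbP τ h hp _ x
  · intro z hz
    obtain ⟨j, -, rfl⟩ := (mem_orbP τ p x z).1 hz
    -- τ^j x = τ^(j + (p - k)) (τ^k x)
    have e : (τ ^ j) x = (τ ^ (j + (p - k))) ((τ ^ k) x) := by
      rw [← Equiv.Perm.mul_apply, ← pow_add, show j + (p - k) + k = j + p by omega, pow_add, h, mul_one]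
    rw [e]; exact pow_apply_mem_orbP τ h hp _ _

/-- **The orbit of a non-fixed point has exactly `p` elements** (`τ ^ p = 1`, `p` prime): a coincidence `τ^i x = τ^j x` with `0 < j - i < p`
would give a period coprime to `p`, hence `τ x = x`. -/
theorem card_orbP_of_ne (τ : Equiv.Perm α) {p : ℕ} (hprime : p.Prime) (h : τ ^ p = 1) {x : α} (hx : τ x ≠ x) : (orbP τ p x).card = p := by
  have hp : 0 < p := hprime.pos
  -- a proper period is impossible
  have noperiod : ∀ d, 0 < d → d < p → (τ ^ d) x = x → False := by
    intro d hd0 hdp hfix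
    have hcop : Nat.Coprime d p := by
      refine Nat.Coprime.symm ((Nat.Prime.coprime_iff_not_dvd hprime).2 fun hdvd => ?_)
      have := Nat.le_of_dvd hd0 hdvd; omega
    obtain ⟨m, -, hm⟩ := Nat.exists_mul_mod_eq_one_of_coprime hcop hprime.one_lt
    have h1 : (τ ^ (d * m)) x = x := by
      rw [pow_mul]; exact Equiv.Perm.pow_apply_eq_self_of_apply_eq_self hfix m
    rw [pow_apply_eq_pow_mod τ h, hm, pow_one] at h1
    exact hx h1
  unfold orbP
  rw [Finset.card_image_of_injOn, card_range]
  intro i hi j hj hij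
  rw [coe_range, Set.mem_Iio] at hi hj
  beta_reduce at hij
  by_contra hne
  -- wlog i < j
  rcases lt_or_gt_of_ne hne with hlt | hlt
  · apply noperiod (j - i) (by omega) (by omega)
    have e : (τ ^ j) x = (τ ^ i) ((τ ^ (j - i)) x) := by
      rw [← Equiv.Perm.mul_apply, ← pow_add, show i + (j - i) = j by omega]
    have := hij.symm
    rw [e] at this
    exact (τ ^ i).injective this
  · apply noperiod (i - j) (by omega) (by omega)
    have e : (τ ^ i) x = (τ ^ j) ((τ ^ (i - j)) x) := by
      rw [← Equiv.Perm.mul_apply, ← pow_add, show j + (i - j) = i by omega]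
    have := hij
    rw [e] at this
    exact (τ ^ j).injective this

end Perm

namespace Collineation

variable {P L : Type*} [Membership P L] (σ : Collineation P L)

variable [ProjectivePlane P L] [Fintype P] [Fintype L]

/-- **Incidence symmetry between a point orbit and a line orbit** (`σ^p = 1`, `p > 0`): with `Q = orbP p₀`, `B = orbP b`,
`#{b' ∈ B : p₀ ∈ b'} · |Q| = #{q ∈ Q : q ∈ b} · |B|`. -/
theorem orbP_incidence_symm {p : ℕ} (hq : σ.onPoints ^ p = 1) (hp : 0 < p) (p₀ : P) (b : L) :
    ((orbP σ.onLines p b).filter fun b' => p₀ ∈ b').card * (orbP σ.onPoints p p₀).card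
      = ((orbP σ.onPoints p p₀).filter fun q => q ∈ b).card * (orbP σ.onLines p b).card := by
  have hqL : σ.onLines ^ p = 1 := σ.onLines_pow_eq_one hq
  set Q := orbP σ.onPoints p p₀ with hQ
  set B := orbP σ.onLines p b with hBdef
  have hQs : ∀ q ∈ Q, σ.onPoints q ∈ Q := fun q hq' => apply_mem_orbP _ hq hp hq'
  have hQs' : ∀ q ∈ Q, ∃ z ∈ Q, σ.onPoints z = q := fun q hq' => exists_apply_eq_of_mem_orbP _ hq hp hq'
  have hBs : ∀ m ∈ B, σ.onLines m ∈ B := fun m hm => apply_mem_orbP _ hqL hp hm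
  have hBs' : ∀ m ∈ B, ∃ z ∈ B, σ.onLines z = m := fun m hm => exists_apply_eq_of_mem_orbP _ hqL hp hm
  -- invariance along powers
  have powP : ∀ (k : ℕ) (q : P), (B.filter fun b' => (σ.onPoints ^ k) q ∈ b').card = (B.filter fun b' => q ∈ b').card := by
    intro k; induction k with
    | zero => intro q; rfl
    | succ k ih => intro q; rw [pow_succ', Equiv.Perm.mul_apply, σ.card_filter_mem_mapPoint hBs hBs', ih]
  have powL : ∀ (k : ℕ) (m : L), (Q.filter fun q => q ∈ (σ.onLines ^ k) m).card = (Q.filter fun q => q ∈ m).card := by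
    intro k; induction k with
    | zero => intro m; rfl
    | succ k ih => intro m; rw [pow_succ', Equiv.Perm.mul_apply, σ.card_filter_mem_mapLine hQs hQs', ih]
  have key1 : ∀ q ∈ Q, (B.filter fun b' => q ∈ b').card = (B.filter fun b' => p₀ ∈ b').card := by
    intro q hq'
    obtain ⟨k, -, rfl⟩ := (mem_orbP _ _ _ _).1 hq'
    exact powP k p₀
  have key2 : ∀ b' ∈ B, (Q.filter fun q => q ∈ b').card = (Q.filter fun q => q ∈ b).card := by
    intro b' hb'
    obtain ⟨k, -, rfl⟩ := (mem_orbP _ _ _ _).1 hb'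
    exact powL k b
  have flags : ∑ q ∈ Q, (B.filter fun b' => q ∈ b').card = ∑ b' ∈ B, (Q.filter fun q => q ∈ b').card := by
    simp only [Finset.card_filter]
    exact Finset.sum_comm
  rw [Finset.sum_congr rfl key1, Finset.sum_congr rfl key2, Finset.sum_const, Finset.sum_const, smul_eq_mul,
    smul_eq_mul] at flags
  rw [mul_comm, flags, mul_comm]

/-- The weight of a point `q` against a non-fixed line `b`: `p·[q ∈ b]` if `q` is fixed, `|orbP q ∩ b|` otherwise. -/
noncomputable def orbWeightP (p : ℕ) (b : L) (q : P) : ℕ :=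
  if σ.onPoints q = q then (if q ∈ b then p else 0) else ((orbP σ.onPoints p q).filter fun q' => q' ∈ b).card

/-- For `σ^p = 1`, `p` prime, and a NON-fixed line `b`: the weight of `q` is the number of lines of the orbit of `b` through `q`. -/
theorem orbWeightP_eq_card {p : ℕ} (hprime : p.Prime) (hq : σ.onPoints ^ p = 1) {b : L} (hb : σ.onLines b ≠ b) (q : P) :
    σ.orbWeightP p b q = ((orbP σ.onLines p b).filter fun b' => q ∈ b').card := by
  have hp : 0 < p := hprime.pos
  have hqL : σ.onLines ^ p = 1 := σ.onLines_pow_eq_one hq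
  have hB : (orbP σ.onLines p b).card = p := card_orbP_of_ne _ hprime hqL hb
  have key := σ.orbP_incidence_symm hq hp q b
  rw [hB] at key
  unfold orbWeightP
  split_ifs with hfix hqb
  · rw [orbP_of_fixed _ hp hfix, card_singleton, mul_one, Finset.filter_singleton, if_pos hqb, card_singleton, one_mul] at key
    exact key.symm
  · rw [orbP_of_fixed _ hp hfix, card_singleton, mul_one, Finset.filter_singleton, if_neg hqb, card_empty, zero_mul] at key
    exact key.symm
  · rw [card_orbP_of_ne _ hprime hq hfix] at key
    exact (Nat.eq_of_mul_eq_mul_right hp key).symm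

/-- **Orbit row identity for prime order** (`λ = 1` summed over a line orbit): for `σ^p = 1` on points, `p` prime, a non-fixed line `b`
with orbit `B` and any line `a`: `Σ_{q ∈ a} orbWeightP b q = p + n · [a ∈ B]`. -/
theorem orbit_row_identity_prime {p : ℕ} (hprime : p.Prime) (hq : σ.onPoints ^ p = 1) {b : L} (hb : σ.onLines b ≠ b) (a : L) :
    ∑ q ∈ univ.filter (fun q : P => q ∈ a), σ.orbWeightP p b q
      = if a ∈ orbP σ.onLines p b then ProjectivePlane.order P L + p else p := by
  have hqL : σ.onLines ^ p = 1 := σ.onLines_pow_eq_one hq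
  set B := orbP σ.onLines p b with hBdef
  have hB : B.card = p := card_orbP_of_ne _ hprime hqL hb
  rw [Finset.sum_congr rfl (fun q _ => σ.orbWeightP_eq_card hprime hq hb q)]
  have fub : ∑ q ∈ univ.filter (fun q : P => q ∈ a), (B.filter fun b' => q ∈ b').card
      = ∑ b' ∈ B, (univ.filter fun q : P => q ∈ a ∧ q ∈ b').card := by
    have e1 : ∀ q : P, (B.filter fun b' => q ∈ b').card = ∑ b' ∈ B, (if q ∈ b' then 1 else 0) :=
      fun q => Finset.card_filter _ _
    have e2 : ∀ b' : L, (univ.filter fun q : P => q ∈ a ∧ q ∈ b').card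
        = ∑ q ∈ univ.filter (fun q : P => q ∈ a), (if q ∈ b' then 1 else 0) := by
      intro b'
      rw [Finset.card_filter, Finset.sum_filter]
      refine Finset.sum_congr rfl fun q _ => ?_
      by_cases h1 : q ∈ a <;> by_cases h2 : q ∈ b' <;> simp [h1, h2]
    simp only [e1, e2]
    exact Finset.sum_comm
  rw [fub, Finset.sum_congr rfl (fun b' _ => card_common_points (P := P) a b')]
  by_cases ha : a ∈ B
  · rw [if_pos ha, ← Finset.add_sum_erase B _ ha, if_pos rfl]
    have : ∑ x ∈ B.erase a, (if a = x then ProjectivePlane.order P L + 1 else 1) = ∑ x ∈ B.erase a, 1 :=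
      Finset.sum_congr rfl fun x hx => by rw [if_neg (Finset.ne_of_mem_erase hx).symm]
    rw [this, Finset.sum_const, smul_eq_mul, mul_one, Finset.card_erase_of_mem ha, hB]
    have := hprime.pos; omega
  · rw [if_neg ha]
    have : ∑ x ∈ B, (if a = x then ProjectivePlane.order P L + 1 else 1) = ∑ x ∈ B, 1 :=
      Finset.sum_congr rfl fun x hx => by rw [if_neg (fun e => ha (by rw [e]; exact hx))]
    rw [this, Finset.sum_const, smul_eq_mul, mul_one, hB]

/-- The dual weight of a line `m` against a non-fixed point: `p·[q ∈ m]` if `m` is fixed, `#{m' ∈ orbP m : q ∈ m'}` otherwise. -/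
noncomputable def orbCoweightP (p : ℕ) (q : P) (m : L) : ℕ :=
  if σ.onLines m = m then (if q ∈ m then p else 0) else ((orbP σ.onLines p m).filter fun m' => q ∈ m').card

/-- **Orbit column identity for prime order** (dual): for a non-fixed point `p₀` with orbit `Q` and any point `q`:
`Σ_{m ∋ q} orbCoweightP p₀ m = p + n · [q ∈ Q]`. -/
theorem orbit_column_identity_prime {p : ℕ} (hprime : p.Prime) (hq : σ.onPoints ^ p = 1) {p₀ : P} (hp₀ : σ.onPoints p₀ ≠ p₀) (q : P) :
    ∑ m ∈ univ.filter (fun m : L => q ∈ m), σ.orbCoweightP p p₀ m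
      = if q ∈ orbP σ.onPoints p p₀ then ProjectivePlane.order P L + p else p := by
  have hqL : σ.onLines ^ p = 1 := σ.onLines_pow_eq_one hq
  have h := σ.dual.orbit_row_identity_prime (a := (q : Dual P)) (b := (p₀ : Dual P)) hprime hqL hp₀
  rw [ProjectivePlane.Dual.order] at h
  exact h

/-! ### Indexed by the orbits themselves -/

/-- The non-trivial point orbits of `σ` (`σ^p = 1`). -/
noncomputable def orbitsP (p : ℕ) : Finset (Finset P) := (univ.filter fun x : P => σ.onPoints x ≠ x).image (orbP σ.onPoints p)

/-- **Orbit-matrix row identity for prime order, indexed by the orbits:** for `σ^p = 1`, `p` prime, a non-fixed line `b` and any line `a`: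
`p · #{q ∈ a ∩ b : σq = q} + Σ_{S ∈ orbitsP} |S ∩ a|·|S ∩ b| = p + n·[a ∈ orbP b]` — the `λ = 1` equation of the tactical decomposition of `⟨σ⟩`,
row by row, with no choice of representatives. -/
theorem orbit_row_identity_orbitsP {p : ℕ} (hprime : p.Prime) (hq : σ.onPoints ^ p = 1) {b : L} (hb : σ.onLines b ≠ b) (a : L) :
    p * (univ.filter fun q : P => q ∈ a ∧ q ∈ b ∧ σ.onPoints q = q).card
      + ∑ S ∈ σ.orbitsP p, (S.filter fun q => q ∈ a).card * (S.filter fun q => q ∈ b).card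
      = if a ∈ orbP σ.onLines p b then ProjectivePlane.order P L + p else p := by
  have hp : 0 < p := hprime.pos
  rw [← σ.orbit_row_identity_prime hprime hq hb a,
    ← Finset.sum_filter_add_sum_filter_not (univ.filter fun q : P => q ∈ a) (fun q => σ.onPoints q = q)]
  congr 1
  · rw [Finset.filter_filter, Finset.card_eq_sum_ones, Finset.mul_sum]
    rw [show (univ.filter fun q : P => q ∈ a ∧ q ∈ b ∧ σ.onPoints q = q)
        = (univ.filter fun q : P => q ∈ a ∧ σ.onPoints q = q).filter (fun q => q ∈ b) by
          ext q; simp only [mem_filter, mem_univ, true_and]; tauto]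
    rw [Finset.sum_filter]
    refine Finset.sum_congr rfl fun q hq' => ?_
    rw [mem_filter] at hq'
    unfold orbWeightP; rw [if_pos hq'.2.2]; split_ifs <;> simp
  · set A := (univ.filter fun q : P => q ∈ a).filter (fun q => ¬ σ.onPoints q = q) with hA
    have hw : ∀ q ∈ A, σ.orbWeightP p b q = ((orbP σ.onPoints p q).filter fun q' => q' ∈ b).card := by
      intro q hq'; rw [hA, mem_filter] at hq'; unfold orbWeightP; rw [if_neg hq'.2]
    rw [Finset.sum_congr rfl hw]
    have himg : ∀ q ∈ A, orbP σ.onPoints p q ∈ σ.orbitsP p := by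
      intro q hq'; rw [hA, mem_filter, mem_filter] at hq'
      exact mem_image.2 ⟨q, mem_filter.2 ⟨mem_univ _, hq'.2⟩, rfl⟩
    rw [← Finset.sum_fiberwise_of_maps_to himg]
    refine Finset.sum_congr rfl fun S hS => ?_
    obtain ⟨x, hx, rfl⟩ := mem_image.1 hS
    rw [mem_filter] at hx
    have hfib : A.filter (fun q => orbP σ.onPoints p q = orbP σ.onPoints p x) = (orbP σ.onPoints p x).filter fun q => q ∈ a := by
      ext q
      simp only [hA, mem_filter, mem_univ, true_and]
      constructor
      · rintro ⟨⟨hqa, -⟩, he⟩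
        exact ⟨by rw [← he]; exact self_mem_orbP _ hp _, hqa⟩
      · rintro ⟨hqx, hqa⟩
        refine ⟨⟨hqa, fun hqf => hx.2 ?_⟩, orbP_eq_of_mem _ hq hp hqx⟩
        -- a fixed point in the orbit of x forces x fixed
        have e := orbP_eq_of_mem σ.onPoints hq hp hqx
        rw [orbP_of_fixed _ hp hqf] at e
        have : x ∈ ({q} : Finset P) := by rw [e]; exact self_mem_orbP _ hp _
        rw [mem_singleton] at this; rw [this]; exact hqf
    rw [hfib, Finset.card_eq_sum_ones ((orbP σ.onPoints p x).filter fun q => q ∈ a), Finset.sum_mul]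
    refine Finset.sum_congr rfl fun q hq' => ?_
    rw [one_mul, orbP_eq_of_mem σ.onPoints hq hp (mem_filter.1 hq').1]

end Collineation

end Summit.Ventures.DiscreteObjects.PP12
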